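import Mathlib
import HarnessLib
import Literature.MathematicalPhysics.QuantumLattice.GrassmannGaussConvKernelBound
import Literature.MathematicalPhysics.QuantumLattice.GrassmannPolchinskiEquation
import Literature.MathematicalPhysics.QuantumLattice.HubbardGridCounterQuadratic
import Summits.HubbardSuperconductivity.HubbardSuperconductivity.Theorems.KLProgrammeKLRegimeWickKernelAntisymm
import Summits.HubbardSuperconductivity.HubbardSuperconductivity.Theorems.KLProgrammeKLRegimeWickDressedDefect
import Summits.HubbardSuperconductivity.HubbardSuperconductivity.Theorems.KLProgrammeKLRegimeEngineCovarianceResponseAtPoint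

/-!
# Route `KLProgramme` — crux K3, ENGINE child (stmt-HubbardSuperconductivity-20437 `KLRegimeEngineV17F2`), stub `stub_engine_step_values`, conjunct (E2-F2):
# the GAUSSIAN-SMEARING DEFECT `(e^{Δ_C} − 1)W` at FIXED legs — bounds, the one-loop formula for diagonal lines, and the two grid-point instances of (R1′)

Cell gate-hubbard-kl, seat hubbard-kl-p1 (g11; (E2) Wick-toolkit lane).  (R1′) cost (iii) / KLTC-INDEX-v5 §B step 4 («grid identification»): the identities
`klw_kernel_dressedVertex_eq` (dressed vertex `W̃` = the `E`-smearing of `𝒲_n − Q`), `klw_dressingDefect_eq` (`E = normalCovariance(−sκm̂(p′(1+m̂)+s))`) and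
`klw_wickPairAmplitude_sub_pairAmplitude` (`𝒞^W_n − 𝒞_n = 𝒱₄[(e^{Δ_{D_n}} − 1)𝒱_n]`) present both grid-point corrections of the (E2) Wick tower as smearing defects
by a NORMAL covariance, read at fixed external legs.  This file sizes them:
* §1 (generic) `norm_kernel_grassmannLaplacian_le`, `…_pow_le_of_sup`, **`norm_kernel_gaussConv_sub_le_of_sup`**:
  `‖kernel_m((e^{Δ_C} − 1)W)(X)‖ ≤ Σ_{1≤j} ((m+2j)!/(m! j! 2^j))·ℓ^j·S(m+2j)`, `ℓ ≥ Σ_{A,B}‖C(A,B)‖`, `S(d) ≥ sup|kernel_d W|` — the twin of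
  `sum_norm_kernel_gaussConv_sub_le` with the roles of line and kernel exchanged (the form a SOFT line needs: summable symbol, large sup); the
  antisymmetry of the last two legs `kernel_snoc_snoc_swap`;
* §2 (model, vertex-function level, any covariance on the Hubbard labels) **`norm_vertexFn_gaussConv_sub_le`** (`0 < m`):
  `‖𝒱_m((e^{Δ_C} − 1)W)(X)‖ ≤ Σ_{1≤j} (j!)⁻¹·(ℓ/(2(βL²)²))^j·V(m+2j)` (the Wick counts are absorbed by the normalisation; for a normal covariance
  `ℓ = 2Σ_{kσ}‖c‖`, `sum_sum_norm_normalCovariance`); the exact ONE-LOOP formula `vertexFn_grassmannLaplacian_normalCovariance(')`: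
  `𝒱_m(Δ_{normalCovariance c}W)(X) = (βL²)⁻²·Σ_{kσ} c(kσ)·𝒱_{m+2}W(X, ψ̂⁻_{kσ}, ψ̂⁺_{kσ})` — the tadpole `∫dk ĝ(k)·𝒱_{m+2}(X,k,k)` for `c = βL²ĝ`;
* §3 (instances) **`norm_klWickPairAmplitude_sub_pairAmplitude_le`** (transfer `T_n`: line = soft symbol of `D_n`, vertices = plain `𝒱_n`) and
  **`norm_vertexFn_dressedVertex_sub_le`** ((R1′) defect: line = defect symbol `e`, vertices = `𝒲_n − Q` = `𝒲_n` in degrees `≠ 2`,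
  `vertexFn_wickAction_sub_twoLegPart`), line mass `Σ‖e‖ ≤ 2Σ‖sκ‖(3‖p′‖+‖s‖)` (`sum_norm_dressingDefect_symbol_le`; only shell values of `κ` enter).
What these ARE and are NOT (TRANSFER-NOTE §2–3, E2-SIGMA-DRESSING §3–4): sign-blind SIZES — `T_n` is `Θ(U²)` n-uniformly (soft tadpole of the sextic tree), the
(R1′) defect is `O(|sκ|)` relative to it; neither is an additive budget line of (E2-F2) (both ride in the composite weight of the door's straddles); the one-loop
formula is the entry point of that structural reading.  Nothing about superconductivity is asserted.  0 kit.
-/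

noncomputable section

namespace Summit.HubbardSuperconductivity.HubbardSuperconductivity.Theorems.KLRegimeWick

set_option linter.dupNamespace false -- summit = problem name (single-conjunct summit), D-0017

open Literature.MathematicalPhysics.QuantumLattice GrassmannAlgebra Finset Matrix
open Literature.Probability.LatticeModels Summit.HubbardSuperconductivity.HubbardSuperconductivity.Theorems.KLProgrammeLegKernels
open Summit.HubbardSuperconductivity.HubbardSuperconductivity.Theorems.KLRegimeSplit
open scoped Nat

/-! ## §1 Generic: the smearing defect at fixed legs (entry mass of the line × sup of the kernels) -/

section Generic

variable {𝕜 : Type*} [RCLike 𝕜] {Γ : Type*} [Fintype Γ]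

/-- Swapping the last two legs: `(X, B, A) ∘ swap(m, m+1) = (X, A, B)`. -/
theorem snoc_snoc_comp_swap {Γ' : Type*} {m : ℕ} (X : Fin m → Γ') (A B : Γ') :
    ((Fin.snoc (Fin.snoc X B : Fin (m + 1) → Γ') A : Fin (m + 2) → Γ') ∘ Equiv.swap (Fin.last m).castSucc (Fin.last m).succ) =
      Fin.snoc (Fin.snoc X A : Fin (m + 1) → Γ') B := by
  funext k
  simp only [Function.comp_apply]
  by_cases h1 : k = (Fin.last m).succ
  · subst h1
    rw [Equiv.swap_apply_right, Fin.succ_last, Fin.snoc_last, Fin.snoc_castSucc, Fin.snoc_last]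
  by_cases h2 : k = (Fin.last m).castSucc
  · subst h2
    rw [Equiv.swap_apply_left, Fin.succ_last, Fin.snoc_last, Fin.snoc_castSucc, Fin.snoc_last]
  rw [Equiv.swap_apply_of_ne_of_ne h2 h1]
  have h1' : k ≠ Fin.last (m + 1) := by rwa [Fin.succ_last] at h1
  obtain ⟨k₁, rfl⟩ := Fin.eq_castSucc_of_ne_last h1'
  have hk₁ : k₁ ≠ Fin.last m := fun h => h2 (by rw [h])
  obtain ⟨k₂, rfl⟩ := Fin.eq_castSucc_of_ne_last hk₁
  simp only [Fin.snoc_castSucc]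

/-- **Antisymmetry in the last two legs**: `kernel_{m+2}W(X, A, B) = −kernel_{m+2}W(X, B, A)` (`iterDeriv_comp_swap_castSucc_succ`). -/
theorem kernel_snoc_snoc_swap {R : Type*} [CommRing R] [Algebra ℚ R] {Γ' : Type*} (W : GrassmannAlgebra R Γ') {m : ℕ} (X : Fin m → Γ')
    (A B : Γ') :
    kernel R W (m + 2) (Fin.snoc (Fin.snoc X A : Fin (m + 1) → Γ') B) = -kernel R W (m + 2) (Fin.snoc (Fin.snoc X B : Fin (m + 1) → Γ') A) := by
  rw [← snoc_snoc_comp_swap X A B, kernel_def, kernel_def, iterDeriv_comp_swap_castSucc_succ R, LinearMap.neg_apply, map_neg, mul_neg]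

/-- **One Laplacian at fixed legs**: `‖kernel_m(Δ_C W)(X)‖ ≤ ((m+1)(m+2)/2)·Σ_{A,B} ‖C(A,B)‖·‖kernel_{m+2}W(X,B,A)‖` (`kernel_grassmannLaplacian`). -/
theorem norm_kernel_grassmannLaplacian_le (C : Matrix Γ Γ 𝕜) (W : GrassmannAlgebra 𝕜 Γ) (m : ℕ) (X : Fin m → Γ) :
    ‖kernel 𝕜 (grassmannLaplacian 𝕜 C W) m X‖ ≤
      (((m + 1) * (m + 2) : ℕ) : ℝ) / 2 * ∑ A, ∑ B, ‖C A B‖ * ‖kernel 𝕜 W (m + 2) (Fin.snoc (Fin.snoc X B : Fin (m + 1) → Γ) A)‖ := by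
  have hcoef : ‖(((((m + 1) * (m + 2) : ℕ) : ℚ) / 2) • (1 : 𝕜))‖ = (((m + 1) * (m + 2) : ℕ) : ℝ) / 2 := by
    rw [Rat.smul_one_eq_cast, ← RCLike.ofReal_ratCast, RCLike.norm_ofReal]
    push_cast
    exact abs_of_nonneg (by positivity)
  rw [kernel_grassmannLaplacian, norm_mul, hcoef]
  refine mul_le_mul_of_nonneg_left ?_ (by positivity)
  refine (norm_sum_le _ _).trans (sum_le_sum fun A _ => (norm_sum_le _ _).trans (sum_le_sum fun B _ => ?_))
  rw [norm_mul]

/-- **One Laplacian, sup form**: `‖kernel_m(Δ_C W)(X)‖ ≤ ((m+1)(m+2)/2)·ℓ·S` (`Σ_{A,B}‖C(A,B)‖ ≤ ℓ`, `S` a sup of the degree-`m+2` kernels). -/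
theorem norm_kernel_grassmannLaplacian_le_of_sup (C : Matrix Γ Γ 𝕜) (W : GrassmannAlgebra 𝕜 Γ) (m : ℕ) {ℓ S : ℝ}
    (hℓ : ∑ A, ∑ B, ‖C A B‖ ≤ ℓ) (hS0 : 0 ≤ S) (hS : ∀ Z : Fin (m + 2) → Γ, ‖kernel 𝕜 W (m + 2) Z‖ ≤ S) (X : Fin m → Γ) :
    ‖kernel 𝕜 (grassmannLaplacian 𝕜 C W) m X‖ ≤ (((m + 1) * (m + 2) : ℕ) : ℝ) / 2 * ℓ * S := by
  refine (norm_kernel_grassmannLaplacian_le C W m X).trans ?_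
  rw [mul_assoc]
  refine mul_le_mul_of_nonneg_left ?_ (by positivity)
  calc ∑ A, ∑ B, ‖C A B‖ * ‖kernel 𝕜 W (m + 2) (Fin.snoc (Fin.snoc X B : Fin (m + 1) → Γ) A)‖
      ≤ ∑ A, ∑ B, ‖C A B‖ * S :=
        sum_le_sum fun A _ => sum_le_sum fun B _ => mul_le_mul_of_nonneg_left (hS _) (norm_nonneg _)
    _ = (∑ A, ∑ B, ‖C A B‖) * S := by rw [sum_mul]; exact sum_congr rfl fun A _ => by rw [sum_mul]
    _ ≤ ℓ * S := mul_le_mul_of_nonneg_right hℓ hS0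

/-- **`j` Laplacians, sup form**: with sups `S(d)` of ALL kernels of `W`, `‖kernel_m(Δ_C^j W)(X)‖ ≤ ((m+2j)!/(m!·2^j))·ℓ^j·S(m+2j)`. -/
theorem norm_kernel_grassmannLaplacian_pow_le_of_sup (C : Matrix Γ Γ 𝕜) {ℓ : ℝ} (hℓ : ∑ A, ∑ B, ‖C A B‖ ≤ ℓ) (W : GrassmannAlgebra 𝕜 Γ)
    (S : ℕ → ℝ) (hS0 : ∀ d, 0 ≤ S d) (hS : ∀ (d : ℕ) (Z : Fin d → Γ), ‖kernel 𝕜 W d Z‖ ≤ S d) :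
    ∀ (j m : ℕ) (X : Fin m → Γ),
      ‖kernel 𝕜 ((grassmannLaplacian 𝕜 C ^ j) W) m X‖ ≤ ((m + 2 * j)! : ℝ) / ((m ! : ℝ) * 2 ^ j) * ℓ ^ j * S (m + 2 * j)
  | 0, m, X => by
    have h := hS m X
    simp only [pow_zero, Module.End.one_apply, Nat.mul_zero, Nat.add_zero, mul_one]
    rwa [div_self (by positivity), one_mul]
  | j + 1, m, X => by
    have hℓ0 : 0 ≤ ℓ := le_trans (sum_nonneg fun A _ => sum_nonneg fun B _ => norm_nonneg _) hℓ
    rw [pow_succ', Module.End.mul_apply]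
    have ih : ∀ Z : Fin (m + 2) → Γ, ‖kernel 𝕜 ((grassmannLaplacian 𝕜 C ^ j) W) (m + 2) Z‖ ≤
        ((m + 2 + 2 * j)! : ℝ) / (((m + 2)! : ℝ) * 2 ^ j) * ℓ ^ j * S (m + 2 + 2 * j) :=
      fun Z => norm_kernel_grassmannLaplacian_pow_le_of_sup C hℓ W S hS0 hS j (m + 2) Z
    refine (norm_kernel_grassmannLaplacian_le_of_sup C _ m hℓ (by have := hS0 (m + 2 + 2 * j); positivity) ih X).trans (le_of_eq ?_)
    have hmf : ((m + 2)! : ℝ) = (m + 2 : ℝ) * ((m + 1 : ℝ) * (m ! : ℝ)) := by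
      rw [show m + 2 = m + 1 + 1 by ring, Nat.factorial_succ, Nat.factorial_succ]; push_cast; ring
    rw [show m + 2 + 2 * j = m + 2 * (j + 1) by ring, hmf]
    have hm0 : (m ! : ℝ) ≠ 0 := by positivity
    push_cast
    field_simp
    ring

/-- **The smearing defect at fixed legs** (`Δ_C^k = 0`, `Σ_{A,B}‖C(A,B)‖ ≤ ℓ`, sups `S(d)` of the kernels of `W`):
`‖kernel_m(e^{Δ_C}W − W)(X)‖ ≤ Σ_{1 ≤ j < k} ((m+2j)!/(m!·j!·2^j))·ℓ^j·S(m+2j)` (degree `4`: `15·ℓ·S(6) + (105/2)·ℓ²·S(8) + …`). -/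
theorem norm_kernel_gaussConv_sub_le_of_sup (C : Matrix Γ Γ 𝕜) {k : ℕ} (hk : grassmannLaplacian 𝕜 C ^ k = 0) {ℓ : ℝ}
    (hℓ : ∑ A, ∑ B, ‖C A B‖ ≤ ℓ) (W : GrassmannAlgebra 𝕜 Γ) (S : ℕ → ℝ) (hS0 : ∀ d, 0 ≤ S d)
    (hS : ∀ (d : ℕ) (Z : Fin d → Γ), ‖kernel 𝕜 W d Z‖ ≤ S d) (m : ℕ) (X : Fin m → Γ) :
    ‖kernel 𝕜 (gaussConv 𝕜 C W - W) m X‖ ≤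
      ∑ j ∈ Ico 1 k, ((m + 2 * j)! : ℝ) / ((m ! : ℝ) * (j ! : ℝ) * 2 ^ j) * ℓ ^ j * S (m + 2 * j) := by
  -- `e^{Δ}W − W = Σ_{1 ≤ j < k} (j!)⁻¹ Δ^j W`
  have hexp : gaussConv 𝕜 C W - W = ∑ j ∈ Ico 1 k, ((j ! : ℚ)⁻¹) • (grassmannLaplacian 𝕜 C ^ j) W := by
    rcases Nat.eq_zero_or_pos k with rfl | hkpos
    · have h1 : (1 : Module.End 𝕜 (GrassmannAlgebra 𝕜 Γ)) = 0 := by rwa [pow_zero] at hk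
      have hW : W = 0 := by simpa using congrArg (fun T : Module.End 𝕜 (GrassmannAlgebra 𝕜 Γ) => T W) h1
      simp [hW]
    · rw [gaussConv, IsNilpotent.exp_eq_sum hk, LinearMap.coe_sum, Finset.sum_apply, range_eq_Ico,
        sum_eq_sum_Ico_succ_bot hkpos]
      simp only [LinearMap.smul_apply, pow_zero, Nat.factorial_zero, Nat.cast_one, inv_one, one_smul,
        Module.End.one_apply, add_sub_cancel_left]
  rw [hexp, kernel_sum]
  refine (norm_sum_le _ _).trans (sum_le_sum fun j _ => ?_)
  rw [← Rat.cast_smul_eq_qsmul 𝕜, kernel_smul, norm_mul, Rat.cast_inv, Rat.cast_natCast, norm_inv, RCLike.norm_natCast]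
  refine (mul_le_mul_of_nonneg_left (norm_kernel_grassmannLaplacian_pow_le_of_sup C hℓ W S hS0 hS j m X) (by positivity)).trans
    (le_of_eq ?_)
  have hj : (j ! : ℝ) ≠ 0 := by positivity
  have hm : (m ! : ℝ) ≠ 0 := by positivity
  field_simp

/-- The same with the uniform nilpotency index `|Γ| + 1`: no hypothesis on `C`. -/
theorem norm_kernel_gaussConv_sub_le_of_sup' (C : Matrix Γ Γ 𝕜) {ℓ : ℝ} (hℓ : ∑ A, ∑ B, ‖C A B‖ ≤ ℓ) (W : GrassmannAlgebra 𝕜 Γ)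
    (S : ℕ → ℝ) (hS0 : ∀ d, 0 ≤ S d) (hS : ∀ (d : ℕ) (Z : Fin d → Γ), ‖kernel 𝕜 W d Z‖ ≤ S d) (m : ℕ) (X : Fin m → Γ) :
    ‖kernel 𝕜 (gaussConv 𝕜 C W - W) m X‖ ≤
      ∑ j ∈ Ico 1 (Fintype.card Γ + 1), ((m + 2 * j)! : ℝ) / ((m ! : ℝ) * (j ! : ℝ) * 2 ^ j) * ℓ ^ j * S (m + 2 * j) :=
  norm_kernel_gaussConv_sub_le_of_sup C (grassmannLaplacian_pow_card_succ_eq_zero 𝕜 C) hℓ W S hS0 hS m X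

end Generic

/-! ## §2 Model, vertex-function level: any covariance on the Hubbard labels; the one-loop formula for diagonal lines -/

section Model

variable (L M : ℕ) [NeZero L]

/-- `kernel = (m!·(βL²)^{m−1})⁻¹ · 𝒱_m` (`vertexFn_def` inverted; `β ≠ 0`). -/
theorem kernel_eq_inv_mul_vertexFn {β : ℝ} (hβ : β ≠ 0) (G : HubbardGrassmann L M) (m : ℕ) (X : Fin m → HubbardFieldIdx L M) :
    kernel ℂ G m X = ((((m ! : ℝ) * (β * (L : ℝ) ^ 2) ^ (m - 1) : ℝ) : ℂ))⁻¹ * vertexFn L M β G m X := by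
  have hL : (L : ℝ) ≠ 0 := Nat.cast_ne_zero.mpr (NeZero.ne L)
  have hc : ((((m ! : ℝ) * (β * (L : ℝ) ^ 2) ^ (m - 1) : ℝ) : ℂ)) ≠ 0 := by
    rw [Ne, Complex.ofReal_eq_zero]
    exact mul_ne_zero (by positivity) (pow_ne_zero _ (mul_ne_zero hβ (pow_ne_zero _ hL)))
  rw [vertexFn_def, ← mul_assoc, inv_mul_cancel₀ hc, one_mul]

omit [NeZero L] in
/-- `‖𝒱_m(G)(X)‖ = m!·(βL²)^{m−1}·‖kernel_m G(X)‖` (`0 < β`). -/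
theorem norm_vertexFn_eq {β : ℝ} (hβ : 0 < β) (G : HubbardGrassmann L M) (m : ℕ) (X : Fin m → HubbardFieldIdx L M) :
    ‖vertexFn L M β G m X‖ = (m ! : ℝ) * (β * (L : ℝ) ^ 2) ^ (m - 1) * ‖kernel ℂ G m X‖ := by
  rw [vertexFn_def, norm_mul, Complex.norm_real, Real.norm_eq_abs, abs_of_nonneg (by positivity)]

/-- **Line reduction for a normal covariance**: `Σ_{A,B} normalCovariance c (A,B)·f(A,B) = Σ_{kσ} c(kσ)·(f(ψ̂⁺_{kσ},ψ̂⁻_{kσ}) − f(ψ̂⁻_{kσ},ψ̂⁺_{kσ}))`. -/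
theorem sum_sum_normalCovariance_mul (c : FreqMomentum L M × Fin 2 → ℂ) (f : HubbardFieldIdx L M → HubbardFieldIdx L M → ℂ) :
    ∑ A, ∑ B, normalCovariance L M c A B * f A B = ∑ p, c p * (f (p, 0) (p, 1) - f (p, 1) (p, 0)) := by
  have h : ∀ A : HubbardFieldIdx L M, ∑ B, normalCovariance L M c A B * f A B =
      normalCovariance L M c A (A.1, 1 - A.2) * f A (A.1, 1 - A.2) := fun A =>
    Finset.sum_eq_single (A.1, 1 - A.2) (fun B _ hB => by rw [EngineV8.normalCovariance_eq_zero_of_ne_bar c A B hB, zero_mul])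
      (fun h => absurd (mem_univ _) h)
  simp_rw [h]
  rw [Fintype.sum_prod_type]
  refine sum_congr rfl fun p _ => ?_
  rw [Fin.sum_univ_two]
  simp only [Fin.isValue, sub_zero, sub_self, (EngineV8.normalCovariance_bar c p).1, (EngineV8.normalCovariance_bar c p).2]
  ring

/-- **The entrywise mass of a normal covariance** is twice the `ℓ¹` mass of its symbol: `Σ_{A,B}‖normalCovariance c (A,B)‖ = 2·Σ_{kσ}‖c(kσ)‖`. -/
theorem sum_sum_norm_normalCovariance (c : FreqMomentum L M × Fin 2 → ℂ) :
    ∑ A, ∑ B, ‖normalCovariance L M c A B‖ = 2 * ∑ p, ‖c p‖ := by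
  have h : ∀ A : HubbardFieldIdx L M, ∑ B, ‖normalCovariance L M c A B‖ = ‖normalCovariance L M c A (A.1, 1 - A.2)‖ := fun A =>
    Finset.sum_eq_single (A.1, 1 - A.2) (fun B _ hB => by rw [EngineV8.normalCovariance_eq_zero_of_ne_bar c A B hB, norm_zero])
      (fun h => absurd (mem_univ _) h)
  simp_rw [h]
  exact EngineV8.sum_norm_normalCovariance_bar c

/-- **The one-loop formula, kernel level**, both orientations: `kernel_m(Δ_{normalCovariance c}W)(X) =
((m+1)(m+2)/2)·Σ_{kσ} c(kσ)·(kernel_{m+2}W(X,ψ̂⁻_{kσ},ψ̂⁺_{kσ}) − kernel_{m+2}W(X,ψ̂⁺_{kσ},ψ̂⁻_{kσ}))`. -/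
theorem kernel_grassmannLaplacian_normalCovariance (c : FreqMomentum L M × Fin 2 → ℂ) (W : HubbardGrassmann L M) (m : ℕ)
    (X : Fin m → HubbardFieldIdx L M) :
    kernel ℂ (grassmannLaplacian ℂ (normalCovariance L M c) W) m X =
      (((((m + 1) * (m + 2) : ℕ) : ℚ) / 2) • (1 : ℂ)) *
        ∑ p, c p * (kernel ℂ W (m + 2) (Fin.snoc (Fin.snoc X ((p, 1) : HubbardFieldIdx L M) : Fin (m + 1) → HubbardFieldIdx L M) (p, 0)) -
          kernel ℂ W (m + 2) (Fin.snoc (Fin.snoc X ((p, 0) : HubbardFieldIdx L M) : Fin (m + 1) → HubbardFieldIdx L M) (p, 1))) := by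
  rw [kernel_grassmannLaplacian, sum_sum_normalCovariance_mul]

/-- **The one-loop formula, vertex-function level** (`0 < m`, `β ≠ 0`), both orientations: `𝒱_m(Δ_{normalCovariance c}W)(X) =
½(βL²)⁻²·Σ_{kσ} c(kσ)·(𝒱_{m+2}W(X,ψ̂⁻_{kσ},ψ̂⁺_{kσ}) − 𝒱_{m+2}W(X,ψ̂⁺_{kσ},ψ̂⁻_{kσ}))`. -/
theorem vertexFn_grassmannLaplacian_normalCovariance {β : ℝ} (hβ : β ≠ 0) (c : FreqMomentum L M × Fin 2 → ℂ) (W : HubbardGrassmann L M)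
    {m : ℕ} (hm : 0 < m) (X : Fin m → HubbardFieldIdx L M) :
    vertexFn L M β (grassmannLaplacian ℂ (normalCovariance L M c) W) m X =
      2⁻¹ * ((((β * (L : ℝ) ^ 2) ^ 2 : ℝ) : ℂ))⁻¹ *
        ∑ p, c p * (vertexFn L M β W (m + 2) (Fin.snoc (Fin.snoc X ((p, 1) : HubbardFieldIdx L M) : Fin (m + 1) → HubbardFieldIdx L M) (p, 0)) -
          vertexFn L M β W (m + 2) (Fin.snoc (Fin.snoc X ((p, 0) : HubbardFieldIdx L M) : Fin (m + 1) → HubbardFieldIdx L M) (p, 1))) := by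
  obtain ⟨m, rfl⟩ : ∃ m', m = m' + 1 := ⟨m - 1, by omega⟩
  have hL : (L : ℂ) ≠ 0 := Nat.cast_ne_zero.mpr (NeZero.ne L)
  have hβ' : (β : ℂ) ≠ 0 := Complex.ofReal_ne_zero.mpr hβ
  -- the scalar identity `(m+1)!(βL²)^m · ((m+2)(m+3)/2) · ((m+3)!(βL²)^{m+2})⁻¹ = ½(βL²)⁻²`
  have hf : (((m + 1 + 2)! : ℕ) : ℂ) = ((m : ℂ) + 1 + 2) * ((m : ℂ) + 1 + 1) * (((m + 1)! : ℕ) : ℂ) := by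
    rw [show m + 1 + 2 = m + 1 + 1 + 1 by ring, Nat.factorial_succ (m + 1 + 1), Nat.factorial_succ (m + 1)]
    push_cast; ring
  have hfc : (((m + 1)! : ℕ) : ℂ) ≠ 0 := by exact_mod_cast Nat.factorial_ne_zero (m + 1)
  have hm3 : ((m : ℂ) + 1 + 2) ≠ 0 := by exact_mod_cast (show (m + 1 + 2 : ℕ) ≠ 0 by omega)
  have hm2 : ((m : ℂ) + 1 + 1) ≠ 0 := by exact_mod_cast (show (m + 1 + 1 : ℕ) ≠ 0 by omega)
  rw [vertexFn_def, kernel_grassmannLaplacian_normalCovariance, ← mul_assoc, mul_sum, mul_sum]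
  refine sum_congr rfl fun p _ => ?_
  rw [kernel_eq_inv_mul_vertexFn L M hβ W (m + 1 + 2), kernel_eq_inv_mul_vertexFn L M hβ W (m + 1 + 2)]
  simp only [Nat.add_sub_cancel, show m + 1 + 2 - 1 = m + 2 by omega, Rat.smul_one_eq_cast]
  push_cast
  rw [hf]
  field_simp
  ring

/-- **The one-loop formula, one orientation** (antisymmetry of the last two legs): `kernel_m(Δ_{normalCovariance c}W)(X) =
(m+1)(m+2)·Σ_{kσ} c(kσ)·kernel_{m+2}W(X, ψ̂⁻_{kσ}, ψ̂⁺_{kσ})`. -/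
theorem kernel_grassmannLaplacian_normalCovariance' (c : FreqMomentum L M × Fin 2 → ℂ) (W : HubbardGrassmann L M) (m : ℕ)
    (X : Fin m → HubbardFieldIdx L M) :
    kernel ℂ (grassmannLaplacian ℂ (normalCovariance L M c) W) m X =
      (((m + 1) * (m + 2) : ℕ) : ℂ) *
        ∑ p, c p * kernel ℂ W (m + 2) (Fin.snoc (Fin.snoc X ((p, 1) : HubbardFieldIdx L M) : Fin (m + 1) → HubbardFieldIdx L M) (p, 0)) := by
  rw [kernel_grassmannLaplacian_normalCovariance, Rat.smul_one_eq_cast, mul_sum, mul_sum]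
  refine sum_congr rfl fun p _ => ?_
  rw [kernel_snoc_snoc_swap W X ((p, 0) : HubbardFieldIdx L M) (p, 1)]
  push_cast
  ring

/-- **The one-loop formula, vertex-function level, one orientation** (`0 < m`, `β ≠ 0`): `𝒱_m(Δ_{normalCovariance c}W)(X) =
(βL²)⁻²·Σ_{kσ} c(kσ)·𝒱_{m+2}W(X, ψ̂⁻_{kσ}, ψ̂⁺_{kσ})` — the textbook tadpole: for `c = βL²ĝ`, `= (βL²)⁻¹Σ_{kσ} ĝ(k)·𝒱_{m+2}W(X, ψ̂⁻_{kσ}, ψ̂⁺_{kσ})`. -/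
theorem vertexFn_grassmannLaplacian_normalCovariance' {β : ℝ} (hβ : β ≠ 0) (c : FreqMomentum L M × Fin 2 → ℂ) (W : HubbardGrassmann L M)
    {m : ℕ} (hm : 0 < m) (X : Fin m → HubbardFieldIdx L M) :
    vertexFn L M β (grassmannLaplacian ℂ (normalCovariance L M c) W) m X =
      ((((β * (L : ℝ) ^ 2) ^ 2 : ℝ) : ℂ))⁻¹ *
        ∑ p, c p * vertexFn L M β W (m + 2) (Fin.snoc (Fin.snoc X ((p, 1) : HubbardFieldIdx L M) : Fin (m + 1) → HubbardFieldIdx L M) (p, 0)) := by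
  have hanti : ∀ p : FreqMomentum L M × Fin 2,
      vertexFn L M β W (m + 2) (Fin.snoc (Fin.snoc X ((p, 0) : HubbardFieldIdx L M) : Fin (m + 1) → HubbardFieldIdx L M) (p, 1)) =
        -vertexFn L M β W (m + 2) (Fin.snoc (Fin.snoc X ((p, 1) : HubbardFieldIdx L M) : Fin (m + 1) → HubbardFieldIdx L M) (p, 0)) :=
    fun p => by rw [vertexFn_def, vertexFn_def, kernel_snoc_snoc_swap W X ((p, 0) : HubbardFieldIdx L M) (p, 1), mul_neg]
  rw [vertexFn_grassmannLaplacian_normalCovariance L M hβ c W hm X]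
  simp_rw [hanti, sub_neg_eq_add, mul_sum]
  refine sum_congr rfl fun p _ => ?_
  ring

/-- **The smearing defect at fixed legs, vertex-function level** (ANY covariance `C` with `Σ_{A,B}‖C(A,B)‖ ≤ ℓ`, sups `V(d)` of `𝒱_d(W)`, `0 < β`, `0 < m`):
`‖𝒱_m(e^{Δ_C}W − W)(X)‖ ≤ Σ_{1 ≤ j ≤ |Γ|} (j!)⁻¹·(ℓ/(2(βL²)²))^j·V(m+2j)` — the Wick counts are absorbed by the vertex-function normalisations. -/
theorem norm_vertexFn_gaussConv_sub_le {β : ℝ} (hβ : 0 < β) (C : Matrix (HubbardFieldIdx L M) (HubbardFieldIdx L M) ℂ) {ℓ : ℝ}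
    (hℓ : ∑ A, ∑ B, ‖C A B‖ ≤ ℓ) (W : HubbardGrassmann L M) (V : ℕ → ℝ) (hV0 : ∀ d, 0 ≤ V d)
    (hV : ∀ (d : ℕ) (Z : Fin d → HubbardFieldIdx L M), ‖vertexFn L M β W d Z‖ ≤ V d) {m : ℕ} (hm : 0 < m)
    (X : Fin m → HubbardFieldIdx L M) :
    ‖vertexFn L M β (gaussConv ℂ C W - W) m X‖ ≤
      ∑ j ∈ Ico 1 (Fintype.card (HubbardFieldIdx L M) + 1),
        (j ! : ℝ)⁻¹ * (ℓ / (2 * (β * (L : ℝ) ^ 2) ^ 2)) ^ j * V (m + 2 * j) := by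
  obtain ⟨m, rfl⟩ : ∃ m', m = m' + 1 := ⟨m - 1, by omega⟩
  have hL : (0 : ℝ) < L := Nat.cast_pos.mpr (Nat.pos_of_ne_zero (NeZero.ne L))
  have ht : 0 < β * (L : ℝ) ^ 2 := mul_pos hβ (pow_pos hL 2)
  have hT : β * (L : ℝ) ^ 2 ≠ 0 := ht.ne'
  have hS0 : ∀ d, 0 ≤ V d / ((d ! : ℝ) * (β * (L : ℝ) ^ 2) ^ (d - 1)) := fun d => div_nonneg (hV0 d) (by positivity)
  have hS : ∀ (d : ℕ) (Z : Fin d → HubbardFieldIdx L M), ‖kernel ℂ W d Z‖ ≤ V d / ((d ! : ℝ) * (β * (L : ℝ) ^ 2) ^ (d - 1)) := by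
    intro d Z
    rw [le_div_iff₀ (by positivity)]
    have h := hV d Z
    rw [norm_vertexFn_eq L M hβ] at h
    calc ‖kernel ℂ W d Z‖ * ((d ! : ℝ) * (β * (L : ℝ) ^ 2) ^ (d - 1)) = (d ! : ℝ) * (β * (L : ℝ) ^ 2) ^ (d - 1) * ‖kernel ℂ W d Z‖ := by
          ring
      _ ≤ V d := h
  rw [norm_vertexFn_eq L M hβ]
  refine (mul_le_mul_of_nonneg_left (norm_kernel_gaussConv_sub_le_of_sup' C hℓ W _ hS0 hS (m + 1) X) (by positivity)).trans (le_of_eq ?_)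
  rw [mul_sum]
  refine sum_congr rfl fun j _ => ?_
  simp only [Nat.add_sub_cancel, show m + 1 + 2 * j - 1 = m + 2 * j by omega]
  have hf1 : ((m + 1)! : ℝ) ≠ 0 := by positivity
  have hf2 : ((m + 1 + 2 * j)! : ℝ) ≠ 0 := by positivity
  have hj : (j ! : ℝ) ≠ 0 := by positivity
  rw [show (β * (L : ℝ) ^ 2) ^ (m + 2 * j) = (β * (L : ℝ) ^ 2) ^ m * ((β * (L : ℝ) ^ 2) ^ 2) ^ j by rw [← pow_mul, ← pow_add],
    show (ℓ / (2 * (β * (L : ℝ) ^ 2) ^ 2)) ^ j = ℓ ^ j / (2 ^ j * ((β * (L : ℝ) ^ 2) ^ 2) ^ j) by rw [div_pow, mul_pow]]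
  -- a scalar identity in the atoms `A = (m+1)!`, `B = (m+1+2j)!`, `P = (βL²)^m`, `Q = ((βL²)²)^j`, `D = 2^j`, `J = j!`
  have key : ∀ (A B P Q D J lj v : ℝ), A ≠ 0 → B ≠ 0 → P ≠ 0 → Q ≠ 0 → D ≠ 0 → J ≠ 0 →
      A * P * (B / (A * J * D) * lj * (v / (B * (P * Q)))) = J⁻¹ * (lj / (D * Q)) * v := by
    intro A B P Q D J lj v hA hB hP hQ hD hJ
    field_simp
  exact key _ _ _ _ _ _ _ _ hf1 hf2 (pow_ne_zero _ hT) (pow_ne_zero _ (pow_ne_zero _ hT)) (pow_ne_zero _ two_ne_zero) hj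

end Model

/-! ## §3 The two grid-point instances of organisation (R1′) -/

section Instances

variable (L M : ℕ) [NeZero L] [NeZero M] {β : ℝ} (U μ : ℝ) (K : TrigPolyC4v)

/-- **The plain ↔ Wick transfer `T_n = 𝒞^W_n − 𝒞_n`, sized**: `D_n = normalCovariance d` (`klw_softCov_eq_normalCovariance`), `2Σ‖d‖ ≤ ℓ`, sups `V(d)` of
the PLAIN `𝒱_d(𝒱_n)`: `‖𝒞^W_n − 𝒞_n‖ ≤ Σ_{1 ≤ j} (j!)⁻¹·(ℓ/(2(βL²)²))^j·V(4+2j)` (soft self-contractions of `𝒱₆, 𝒱₈, …`; leading term = the soft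
tadpole of the sextic tree, `Θ(U²)` n-uniformly, TRANSFER-NOTE §2 — a size, not a budget line). -/
theorem norm_klWickPairAmplitude_sub_pairAmplitude_le (hβ : 0 < β) (n : ℕ) (d : FreqMomentum L M × Fin 2 → ℂ)
    (hd : klSoftCov L M β μ K n = normalCovariance L M d) {ℓ : ℝ} (hℓ : 2 * ∑ p, ‖d p‖ ≤ ℓ) (V : ℕ → ℝ) (hV0 : ∀ m, 0 ≤ V m)
    (hV : ∀ (m : ℕ) (Z : Fin m → HubbardFieldIdx L M), ‖vertexFn L M β (klEffectiveAction L M β U μ K klE0 n) m Z‖ ≤ V m)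
    (Q k k' : TorusSite 2 L) :
    ‖klWickPairAmplitude L M β U μ K n Q k k' - klPairAmplitude L M β U μ K n Q k k'‖ ≤
      ∑ j ∈ Ico 1 (Fintype.card (HubbardFieldIdx L M) + 1),
        (j ! : ℝ)⁻¹ * (ℓ / (2 * (β * (L : ℝ) ^ 2) ^ 2)) ^ j * V (4 + 2 * j) := by
  rw [klw_wickPairAmplitude_sub_pairAmplitude, hd]
  have hℓ' : ∑ A, ∑ B, ‖normalCovariance L M d A B‖ ≤ ℓ := by rw [sum_sum_norm_normalCovariance]; exact hℓ
  exact norm_vertexFn_gaussConv_sub_le L M hβ _ hℓ' _ V hV0 hV (by norm_num) _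

/-- The same with the exact sups `vertexSupNorm` of the plain vertex functions (no hypothesis on `V`). -/
theorem norm_klWickPairAmplitude_sub_pairAmplitude_le_vertexSupNorm (hβ : 0 < β) (n : ℕ) (d : FreqMomentum L M × Fin 2 → ℂ)
    (hd : klSoftCov L M β μ K n = normalCovariance L M d) {ℓ : ℝ} (hℓ : 2 * ∑ p, ‖d p‖ ≤ ℓ) (Q k k' : TorusSite 2 L) :
    ‖klWickPairAmplitude L M β U μ K n Q k k' - klPairAmplitude L M β U μ K n Q k k'‖ ≤
      ∑ j ∈ Ico 1 (Fintype.card (HubbardFieldIdx L M) + 1),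
        (j ! : ℝ)⁻¹ * (ℓ / (2 * (β * (L : ℝ) ^ 2) ^ 2)) ^ j * vertexSupNorm L M β (klEffectiveAction L M β U μ K klE0 n) (4 + 2 * j) :=
  norm_klWickPairAmplitude_sub_pairAmplitude_le L M U μ K hβ n d hd hℓ _ (fun m => vertexSupNorm_nonneg L M β _ m)
    (fun m Z => norm_vertexFn_le_vertexSupNorm L M β _ m Z) Q k k'

omit [NeZero M] in
/-- **The two-leg part is invisible in degrees `≠ 2`**: for `Q = Σ_{kσ} κ(kσ)ψ̂⁺_{kσ}ψ̂⁻_{kσ}` and `d ≠ 2`, `𝒱_d(𝒲_n − Q) = 𝒱_d(𝒲_n)`. -/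
theorem vertexFn_wickAction_sub_twoLegPart (n : ℕ) (κ : FreqMomentum L M × Fin 2 → ℂ) (Q : HubbardGrassmann L M)
    (hQ : Q = ∑ ks : FreqMomentum L M × Fin 2, κ ks • (gen ℂ ((ks, 0) : HubbardFieldIdx L M) * gen ℂ ((ks, 1) : HubbardFieldIdx L M)))
    {d : ℕ} (hd : d ≠ 2) (Z : Fin d → HubbardFieldIdx L M) :
    vertexFn L M β (klWickAction L M β U μ K n - Q) d Z = vertexFn L M β (klWickAction L M β U μ K n) d Z := by
  rw [klw_vertexFn_sub, sub_eq_self, vertexFn_def, hQ, kernel_sum]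
  refine mul_eq_zero_of_right _ (sum_eq_zero fun ks _ => ?_)
  rw [kernel_smul, kernel_gen_mul_gen_of_ne _ _ hd, mul_zero]

omit [NeZero M] in
/-- **The defect line's mass** (`‖sκ‖ ≤ ½`): `Σ‖e‖ ≤ 2·Σ ‖sκ‖·(3‖p′‖ + ‖s‖)` for `e = −sκm̂(p′(1+m̂)+s)` (`norm_dressingDefect_symbol_le` summed; `s` lives on
the slice shell, so only the shell values of `κ` enter). -/
theorem sum_norm_dressingDefect_symbol_le (p' s κ : FreqMomentum L M × Fin 2 → ℂ) (h : ∀ ks, ‖s ks * κ ks‖ ≤ 1 / 2) :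
    ∑ ks, ‖-(s ks * κ ks * (1 + s ks * κ ks)⁻¹) * (p' ks * (1 + (1 + s ks * κ ks)⁻¹) + s ks)‖ ≤
      2 * ∑ ks, ‖s ks * κ ks‖ * (3 * ‖p' ks‖ + ‖s ks‖) := by
  rw [mul_sum]
  exact sum_le_sum fun ks _ => by rw [← mul_assoc]; exact norm_dressingDefect_symbol_le (h ks)

omit [NeZero M] in
/-- **The (R1′) dressing defect at fixed legs, sized** (notation of `klw_wickAction_succ_dressed` / `klw_dressingDefect_eq`, step `n → n+1`): with
`2Σ_{kσ}‖e(kσ)‖ ≤ ℓ` for the defect symbol `e = −sκm̂(p′(1+m̂)+s)` and sups `V(d)` of the vertex functions of `𝒲_n − Q`, in every degree `d+1`: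
`‖𝒱_{d+1}(W̃)(X) − 𝒱_{d+1}(𝒲_n − Q)(X)‖ ≤ Σ_{1 ≤ j} (j!)⁻¹·(ℓ/(2(βL²)²))^j·V(d+1+2j)`, `W̃ = e^{Δ_{D^m+g̃}}V′` — first order in the line mass
`(βL²)⁻²Σ‖e‖ = O(|sκ|)·(slice + soft tadpole mass)`: the (R1′) cost (iii) of E2-SIGMA-DRESSING §6, as a size. -/
theorem norm_vertexFn_dressedVertex_sub_le (hβ : 0 < β) (n : ℕ) (p' s κ : FreqMomentum L M × Fin 2 → ℂ) (m : HubbardFieldIdx L M → ℂ)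
    (Q V' : HubbardGrassmann L M) (gt Dm : Matrix (HubbardFieldIdx L M) (HubbardFieldIdx L M) ℂ)
    (hp' : klSoftCov L M β μ K (n + 1) = normalCovariance L M p') (hs : klSliceCov L M β μ K (n + 1) = normalCovariance L M s)
    (hm : m = fun X => (1 + s X.1 * κ X.1)⁻¹)
    (hgt : gt = normalCovariance L M fun ks => s ks / (1 + s ks * κ ks))
    (hDm : Dm = Matrix.of fun X Y => m X * m Y * klSoftCov L M β μ K (n + 1) X Y)
    (hden : ∀ ks : FreqMomentum L M × Fin 2, 1 + s ks * κ ks ≠ 0)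
    (hQ : Q = ∑ ks : FreqMomentum L M × Fin 2, κ ks • (gen ℂ ((ks, 0) : HubbardFieldIdx L M) * gen ℂ ((ks, 1) : HubbardFieldIdx L M)))
    (hV' : V' = klEffectiveAction L M β U μ K klE0 n - Q)
    {ℓ : ℝ} (hℓ : 2 * ∑ ks, ‖-(s ks * κ ks * (1 + s ks * κ ks)⁻¹) * (p' ks * (1 + (1 + s ks * κ ks)⁻¹) + s ks)‖ ≤ ℓ)
    (V : ℕ → ℝ) (hV0 : ∀ d, 0 ≤ V d)
    (hV : ∀ (d : ℕ) (Z : Fin d → HubbardFieldIdx L M), ‖vertexFn L M β (klWickAction L M β U μ K n - Q) d Z‖ ≤ V d)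
    {d : ℕ} (X : Fin (d + 1) → HubbardFieldIdx L M) :
    ‖vertexFn L M β (gaussConv ℂ (Dm + gt) V') (d + 1) X - vertexFn L M β (klWickAction L M β U μ K n - Q) (d + 1) X‖ ≤
      ∑ j ∈ Ico 1 (Fintype.card (HubbardFieldIdx L M) + 1),
        (j ! : ℝ)⁻¹ * (ℓ / (2 * (β * (L : ℝ) ^ 2) ^ 2)) ^ j * V (d + 1 + 2 * j) := by
  -- the difference is the vertex function of the `E`-smearing defect of `𝒲_n − Q`
  have hE := klw_dressingDefect_eq L M β μ K n p' s κ m gt Dm hp' hs hm hgt hDm hden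
  have hdiff : vertexFn L M β (gaussConv ℂ (Dm + gt) V') (d + 1) X - vertexFn L M β (klWickAction L M β U μ K n - Q) (d + 1) X =
      vertexFn L M β (gaussConv ℂ (Dm + gt - klSoftCov L M β μ K n) (klWickAction L M β U μ K n - Q) - (klWickAction L M β U μ K n - Q))
        (d + 1) X := by
    have hk := klw_kernel_dressedVertex_eq L M β U μ K n κ Q V' gt Dm hQ hV' X
    simp only [vertexFn_def, kernel_sub', hk]
    ring
  rw [hdiff, hE]
  have hℓ' : ∑ A, ∑ B, ‖normalCovariance L M (fun ks => -(s ks * κ ks * (1 + s ks * κ ks)⁻¹) * (p' ks * (1 + (1 + s ks * κ ks)⁻¹) + s ks)) A B‖ ≤ ℓ := by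
    rw [sum_sum_norm_normalCovariance]; exact hℓ
  exact norm_vertexFn_gaussConv_sub_le L M hβ _ hℓ' _ V hV0 hV (Nat.succ_pos d) X

end Instances

end Summit.HubbardSuperconductivity.HubbardSuperconductivity.Theorems.KLRegimeWick

end
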